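import Mathlib
import Literature.NumberTheory.LFunctions.Zhang2022.Section8aStatements
import Literature.NumberTheory.LFunctions.Zhang2022.Section2Lemma23Inputs
import Literature.Analysis.Complex.RectangleResidueSimplePoles
import HarnessLib

/-!
# Zhang (2022) §8 (8.1), first equality: "By … the residue theorem,
# `Σ_{ρ∈𝒵(ψ)} 𝒞*(ρ,ψ)A(𝐚₁;ρ,ψ)A(𝐚₂,1−ρ,ψ̄)ω(ρ) = (1/2πi)∫_ℜ 𝒞̃(s,ψ)A(𝐚₁;s,ψ)A(𝐚₂,1−s,ψ̄)ω(s) ds`"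
# — `Z22:(8.1)`a from Proposition 2.2, kernel-checked

Topic `Literature/NumberTheory/LFunctions/Zhang2022` (Landau–Siegel adjudication tree;
verdict-neutral). Y. Zhang, *Discrete mean estimates and the Landau–Siegel zero*,
arXiv:2211.02515v1 (2022) [Zhang2022LandauSiegel] — an unrefereed manuscript under adjudication.
DAG node `Z22:(8.1)` [Z22 p.42, tex L2202–L2203], proof of Lemma 8.1 (first equality):

> By Lemma 5.9, the residue theorem and a simple bound for `ω(s)`,
> `Σ_{ρ∈Z̃(ψ)} 𝒞*(ρ,ψ)A(𝐚₁;ρ,ψ)A(𝐚₂,1−ρ,ψ̄)ω(ρ) = (1/2πi)∫_ℜ 𝒞̃(s,ψ)A(𝐚₁;s,ψ)A(𝐚₂,1−s,ψ̄)ω(s) ds = …`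

where `𝒞̃(s,ψ) = −iM(s+β₁,ψ)M(s+β₂,ψ)M(s+β₃,ψ)/M(s,ψ)` (tex L2194) and `ℜ` is the admissible rectangle
of `Z22:§8.u003`. The typed statement is the CLAIM node `Section8aStatements.Eq81a c′` (L2-t7,
p413083): for every admissible rectangle (`AdmRect D x C c₀ Lm Lp`, `c₀ > 0`),
`sumZeros c′ x 𝐚₁ 𝐚₂ = rectIntegral D Lm Lp (integrandTilde c′ x 𝐚₁ 𝐚₂)`. This file PROVES it
from `Skeleton.Prop22 c′` (`c′ ≥ 0`; (ii) gives the simplicity of the poles, (i) is not needed),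
by the tree's residue theorem for finitely many simple poles on a rectangle
(`Literature.Analysis.Complex.rectBoundaryIntegral_eq_sum_of_simplePoles`, Conway V.2.2):

the integrand `𝒞̃A₁Ā₂ω = G/M` has `G(s) = −iM(s+β₁)M(s+β₂)M(s+β₃)A(𝐚₁;s)A(𝐚₂;1−s,ψ̄)ω(s)`
holomorphic near the closed rectangle (`M = Y·L(·,ψ)` holomorphic on the upper half-plane,
`Im β_j ≥ 0`, `A` a finite Dirichlet polynomial, `ω` entire); its poles in a `c₀α/2`-collar of the
closed rectangle are the zeros of `L(s,ψ)` there, i.e. exactly `𝒵(ψ)` (a zero in the collar would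
be within `c₀α` of its projection onto `ℜ`); each pole is simple (Prop. 2.2 (ii) ⇒ `M′(ρ,ψ) ≠ 0`),
`𝒞̃A₁Ā₂ω = φ_ρ/(z−ρ)` with `φ_ρ = G/dslope M ρ`, `φ_ρ(ρ) = 𝒞*(ρ)A₁(ρ)Ā₂(1−ρ)ω(ρ)`.
Main results: `eq81a_at` (one character, one admissible rectangle) and
`eq81a_of_prop22 : 0 ≤ c′ → Skeleton.Prop22 c′ → Eq81a c′`. No new definitions, no named facts;
nothing here bears on Theorems 1–2 of the source or on the cell's verdict on (8.24). Cell
siegel-zhang (D-0069), cone C19 (`Ded81`), L2 DISCHARGE LEDGER #5 (R10).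

## References

* Y. Zhang, arXiv:2211.02515v1 (2022), §8, proof of Lemma 8.1, (8.1) p. 42 (tex L2194–L2206).
  [cite: Zhang2022LandauSiegel, §8 (8.1) p. 42]
* J. B. Conway, *Functions of One Complex Variable I*, 2nd ed. (1978), Ch. V Thm. 2.2 (residue
  theorem; the tree's `RectangleResidueSimplePoles`). [cite: Conway1978, Ch. V Thm. 2.2]
-/

noncomputable section

open Complex Real Set Filter Topology

namespace Literature.NumberTheory.LFunctions.Zhang2022.Section8aStatements

open Literature.NumberTheory.LFunctions.Zhang2022 Skeleton
open Literature.Analysis.Complex (rectBoundaryIntegral rectBoundaryIntegral_eq_sum_of_simplePoles)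

/-- Clamping `v` into `[lo, hi]` (the projection onto the closed rectangle, coordinatewise): the
clamped value lies in `[lo, hi]`, is within `δ` of `v` when `lo − δ < v < hi + δ`, and sits at the
corresponding end when `v` is outside. [folklore] -/
private theorem clamp_spec {lo hi v δ : ℝ} (hlh : lo ≤ hi) (hδ : 0 < δ) (h1 : lo - δ < v)
    (h2 : v < hi + δ) :
    lo ≤ max lo (min hi v) ∧ max lo (min hi v) ≤ hi ∧ |max lo (min hi v) - v| < δ ∧
      (v ≤ lo → max lo (min hi v) = lo) ∧ (hi ≤ v → max lo (min hi v) = hi) := by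
  refine ⟨le_max_left _ _, max_le hlh (min_le_left _ _), ?_, ?_, ?_⟩
  · rcases le_total hi v with h | h
    · rw [min_eq_left h, max_eq_right hlh, abs_lt]
      constructor <;> linarith
    · rw [min_eq_right h]
      rcases le_total lo v with h' | h'
      · rw [max_eq_right h', sub_self, abs_zero]; exact hδ
      · rw [max_eq_left h', abs_lt]
        constructor <;> linarith
  · intro hv
    rw [min_eq_right (le_trans hv hlh), max_eq_left hv]
  · intro hv
    rw [min_eq_left hv, max_eq_right hlh]

section Setting

variable {D : ℕ} [NeZero D] (χ : DirichletCharacter ℂ D)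

/-! ## Holomorphy of the pieces of the integrand -/

omit [NeZero D] in
/-- A finite Dirichlet polynomial `Σ_{n<N} a(n)θ(n)n^{−s}` is complex differentiable at every
`s ≠ 0` (the term `n = 0` is the function `0^{−s}`, differentiable away from `s = 0`).
[cite: Zhang2022LandauSiegel, §7 p. 33 (after (7.2))] -/
theorem differentiableAt_dirPoly {k : ℕ} [NeZero k] (N : ℕ) (a : ℕ → ℂ)
    (θ : DirichletCharacter ℂ k) {s : ℂ} (hs : s ≠ 0) :
    DifferentiableAt ℂ (fun z => Lemma81.dirPoly N a θ z) s := by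
  have h : (fun z => Lemma81.dirPoly N a θ z) =
      fun z => ∑ n ∈ Finset.range N, a n * θ n * (n : ℂ) ^ (-z) := by
    funext z; rw [Lemma81.dirPoly_def]
  rw [h]
  refine DifferentiableAt.fun_sum fun n _ => ?_
  exact ((differentiableAt_id.neg.const_cpow (Or.inr (by simpa using hs))).const_mul _)

omit [NeZero D] in
/-- `ω` is entire (a Gaussian). [cite: Zhang2022LandauSiegel, §2 (2.15)] -/
theorem differentiable_omegaW (D : ℕ) : Differentiable ℂ (omegaW D) := by
  have h : omegaW D = fun s => ((Real.sqrt π / ell2 D : ℝ) : ℂ) *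
      cexp ((s - SmoothWeight.s0 (t0 D)) ^ 2 / (4 * (ell2 D : ℂ) ^ 2)) := by
    funext s; rfl
  rw [h]
  fun_prop

omit [NeZero D] in
/-- `s ↦ M(s + β, ψ)` is complex differentiable at `s` when `Im(s + β) > 0`.
[cite: Zhang2022LandauSiegel, §2 p. 5] -/
theorem differentiableAt_Mfun_shift (x : Chr D) (β : ℂ) {s : ℂ} (hs : 0 < (s + β).im) :
    DifferentiableAt ℂ (fun z => Mfun x.ψ (z + β)) s := by
  have hUo : IsOpen {s : ℂ | 0 < s.im} := isOpen_lt continuous_const Complex.continuous_im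
  have hM : DifferentiableAt ℂ (Mfun x.ψ) (s + β) :=
    (differentiableOn_Mfun x).differentiableAt (hUo.mem_nhds hs)
  exact hM.comp s (differentiableAt_id.add_const β)

/-! ## The residue identity at one character and one admissible rectangle -/

omit [NeZero D] in
/-- The numerator `G(s) = −iM(s+β₁)M(s+β₂)M(s+β₃)·A(𝐚₁;s,ψ)A(𝐚₂;1−s,ψ̄)ω(s)` of the integrand of
(8.1) is complex differentiable at every `s` with `Im s > 0`, `s ≠ 0`, `1 − s ≠ 0`, once the
shifts have `Im β_j ≥ 0`. [cite: Zhang2022LandauSiegel, §8 (8.1) p. 42] -/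
theorem differentiableAt_numerator (c' : ℝ) (x : Chr D) (a₁ a₂ : ℕ → ℂ)
    (hb1 : 0 ≤ (beta1 c' D).im) (hb2 : 0 ≤ (beta2 c' D).im) (hb3 : 0 ≤ (beta3 c' D).im)
    {s : ℂ} (hs : 0 < s.im) (hs0 : s ≠ 0) (hs1 : 1 - s ≠ 0) :
    DifferentiableAt ℂ (fun z => -I * (Mfun x.ψ (z + beta1 c' D) * Mfun x.ψ (z + beta2 c' D) *
      Mfun x.ψ (z + beta3 c' D)) * Apoly x a₁ z * ApolyBar x a₂ (1 - z) * omegaW D z) s := by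
  have h1 := differentiableAt_Mfun_shift x (beta1 c' D) (s := s) (by rw [Complex.add_im]; linarith)
  have h2 := differentiableAt_Mfun_shift x (beta2 c' D) (s := s) (by rw [Complex.add_im]; linarith)
  have h3 := differentiableAt_Mfun_shift x (beta3 c' D) (s := s) (by rw [Complex.add_im]; linarith)
  have hA : DifferentiableAt ℂ (fun z => Apoly x a₁ z) s := differentiableAt_dirPoly _ _ _ hs0
  have hB : DifferentiableAt ℂ (fun z => ApolyBar x a₂ (1 - z)) s := by
    have h := differentiableAt_dirPoly (Nsupp D) a₂ x.ψ⁻¹ hs1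
    exact h.comp s ((differentiableAt_const _).sub differentiableAt_id)
  have hω : DifferentiableAt ℂ (omegaW D) s := (differentiable_omegaW D) s
  exact ((((differentiableAt_const _).mul ((h1.mul h2).mul h3)).mul hA).mul hB).mul hω

/-- **(8.1), first equality, at one character and one admissible rectangle** — the residue
theorem: for `D ≥ 3`, `χ` primitive, shifts with `Im β_j ≥ 0`, `0 < α`, `c₀ > 0`, heights with
`2πt₀ + 𝓛₁⁻ > c₀α` (so that the collar lies in the upper half-plane) and `𝓛₁⁻ < 𝓛₁⁺`, a character
`ψ` whose `Ω`-zeros of `L(s,ψ)L(s,ψχ)` are simple (Prop. 2.2 (ii)), and an admissible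
rectangle: `Σ_{ρ∈𝒵(ψ)} 𝒞*(ρ)A₁(ρ)Ā₂(1−ρ)ω(ρ) = (1/2πi)∮_{∂ℜ} 𝒞̃A₁Ā₂ω`.
[cite: Zhang2022LandauSiegel, §8 (8.1) p. 42, tex L2202–L2203] -/
theorem eq81a_at (hD : 3 ≤ D) (hχ : χ.IsPrimitive) (c' : ℝ) (x : Chr D) (a₁ a₂ : ℕ → ℂ)
    (hb1 : 0 ≤ (beta1 c' D).im) (hb2 : 0 ≤ (beta2 c' D).im) (hb3 : 0 ≤ (beta3 c' D).im)
    {C c₀ Lm Lp : ℝ} (hc₀ : 0 < c₀) (hα : 0 < alpha D)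
    (hLmpos : c₀ * alpha D < 2 * π * t0 D + Lm) (hLmLp : Lm < Lp)
    (h_ii : ∀ s ∈ prodZeroSetOmega χ x,
      deriv (fun w => x.ψ.LFunction w * (psiChi χ x).LFunction w) s ≠ 0)
    (hR : AdmRect D x C c₀ Lm Lp) :
    sumZeros c' x a₁ a₂ = rectIntegral D Lm Lp (integrandTilde c' x a₁ a₂) := by
  obtain ⟨hLp1, hLm1, hzeros, hdist⟩ := hR
  set T : ℝ := 2 * π * t0 D with hT
  set δ : ℝ := c₀ * alpha D / 2 with hδ
  have hδ0 : 0 < δ := by positivity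
  -- the integrand as `G/M`
  set F : ℂ → ℂ := integrandTilde c' x a₁ a₂ with hF_def
  set G : ℂ → ℂ := fun z => -I * (Mfun x.ψ (z + beta1 c' D) * Mfun x.ψ (z + beta2 c' D) *
      Mfun x.ψ (z + beta3 c' D)) * Apoly x a₁ z * ApolyBar x a₂ (1 - z) * omegaW D z with hG_def
  have hFG : ∀ z, F z = G z / Mfun x.ψ z := by
    intro z
    simp only [hF_def, hG_def, integrandTilde, calCt, div_eq_mul_inv]
    ring
  -- the finite set of poles
  have hfin : (zeroSet D x).Finite := zerosFinite_holds D x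
  set S : Finset ℂ := finsetOf (zeroSet D x) with hS_def
  have hmemS : ∀ z, z ∈ S ↔ z ∈ zeroSet D x := fun z => mem_finsetOf hfin
  have hzeroR : ∀ {z}, z ∈ zeroSet D x → z ∈ rectR D Lm Lp := fun {z} hz => by
    have h : z ∈ {ρ | x.ψ.LFunction ρ = 0 ∧ ρ ∈ rectR D Lm Lp} := by rw [hzeros]; exact hz
    exact h.2
  -- the open collar `U` around the closed rectangle
  set U : Set ℂ := Ioo (1 / 2 - alpha D - δ) (1 / 2 + alpha D + δ) ×ℂ Ioo (T + Lm - δ) (T + Lp + δ)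
    with hU_def
  have hUo : IsOpen U := isOpen_Ioo.reProdIm isOpen_Ioo
  have hKU : Icc (1 / 2 - alpha D) (1 / 2 + alpha D) ×ℂ Icc (T + Lm) (T + Lp) ⊆ U := by
    intro z hz
    rw [mem_reProdIm] at hz ⊢
    exact ⟨⟨by linarith [hz.1.1], by linarith [hz.1.2]⟩, ⟨by linarith [hz.2.1], by linarith [hz.2.2]⟩⟩
  have hUim : ∀ z ∈ U, 0 < z.im := fun z hz => by
    rw [mem_reProdIm] at hz; linarith [hz.2.1]
  have hU0 : ∀ z ∈ U, z ≠ 0 := fun z hz h => by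
    have := hUim z hz; rw [h, Complex.zero_im] at this; exact lt_irrefl _ this
  have hU1 : ∀ z ∈ U, 1 - z ≠ 0 := fun z hz h => by
    have := hUim z hz; rw [(sub_eq_zero.mp h).symm, Complex.one_im] at this; exact lt_irrefl _ this
  -- a zero of `L(s,ψ)` in the collar lies in `𝒵(ψ)` (else it is within `c₀α` of `∂ℜ`)
  have hLzero : ∀ z ∈ U, x.ψ.LFunction z = 0 → z ∈ zeroSet D x := by
    intro z hz hL
    by_cases hrect : z ∈ rectR D Lm Lp
    · have h : z ∈ {ρ | x.ψ.LFunction ρ = 0 ∧ ρ ∈ rectR D Lm Lp} := ⟨hL, hrect⟩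
      rwa [hzeros] at h
    · exfalso
      rw [mem_reProdIm] at hz
      obtain ⟨⟨hzr1, hzr2⟩, ⟨hzi1, hzi2⟩⟩ := hz
      obtain ⟨hr1, hr2, hr3, hr4, hr5⟩ :=
        clamp_spec (lo := 1 / 2 - alpha D) (hi := 1 / 2 + alpha D) (v := z.re) (by linarith) hδ0
          hzr1 hzr2
      obtain ⟨hi1, hi2, hi3, hi4, hi5⟩ :=
        clamp_spec (lo := T + Lm) (hi := T + Lp) (v := z.im) (by linarith) hδ0 hzi1 hzi2
      set s : ℂ := ⟨max (1 / 2 - alpha D) (min (1 / 2 + alpha D) z.re),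
        max (T + Lm) (min (T + Lp) z.im)⟩ with hs_def
      have hsre : s.re = max (1 / 2 - alpha D) (min (1 / 2 + alpha D) z.re) := rfl
      have hsim : s.im = max (T + Lm) (min (T + Lp) z.im) := rfl
      have hsB : s ∈ onBoundaryR D Lm Lp := by
        refine ⟨⟨?_, ?_, ?_⟩, fun hsR => hrect ?_⟩
        · rw [hsre, abs_le]; constructor <;> linarith
        · rw [hsim]; exact hi1
        · rw [hsim]; exact hi2
        · obtain ⟨h1, h2, h3⟩ := hsR
          rw [hsre] at h1
          rw [hsim] at h2 h3
          refine ⟨?_, ?_, ?_⟩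
          · by_contra hc
            rw [not_lt] at hc
            rcases le_abs'.mp hc with h | h
            · rw [hr4 (by linarith)] at h1
              rw [abs_lt] at h1
              linarith [h1.1]
            · rw [hr5 (by linarith)] at h1
              rw [abs_lt] at h1
              linarith [h1.2]
          · by_contra hc
            rw [not_lt] at hc
            rw [hi4 hc] at h2
            exact lt_irrefl _ h2
          · by_contra hc
            rw [not_lt] at hc
            rw [hi5 hc] at h3
            exact lt_irrefl _ h3
      have hfar := hdist s hsB z hL
      have hnear : ‖s - z‖ < c₀ * alpha D := by
        have h := Complex.norm_le_abs_re_add_abs_im (s - z)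
        rw [Complex.sub_re, Complex.sub_im, hsre, hsim] at h
        have : c₀ * alpha D = δ + δ := by rw [hδ]; ring
        linarith
      linarith
  -- `M ≠ 0` on `U ∖ S`, and the integrand is holomorphic there
  have hMne : ∀ z ∈ U, z ∉ zeroSet D x → Mfun x.ψ z ≠ 0 := fun z hz hzS =>
    Mfun_ne_zero x (hUim z hz) (fun hL => hzS (hLzero z hz hL))
  have hUH : U ⊆ {s : ℂ | 0 < s.im} := fun z hz => hUim z hz
  have hMdiff : DifferentiableOn ℂ (Mfun x.ψ) U := (differentiableOn_Mfun x).mono hUH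
  have hFdiff : DifferentiableOn ℂ F (U \ ↑S) := by
    intro z hz
    obtain ⟨hzU, hzS⟩ := hz
    have hzS' : z ∉ zeroSet D x := fun h => hzS (Finset.mem_coe.mpr ((hmemS z).mpr h))
    have hGd := differentiableAt_numerator c' x a₁ a₂ hb1 hb2 hb3 (hUim z hzU) (hU0 z hzU)
      (hU1 z hzU)
    have hMd : DifferentiableAt ℂ (Mfun x.ψ) z := hMdiff.differentiableAt (hUo.mem_nhds hzU)
    have h := hGd.div hMd (hMne z hzU hzS')
    have hFeq : F = fun z => G z / Mfun x.ψ z := funext hFG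
    rw [hFeq]
    exact h.differentiableWithinAt
  -- the poles are simple, with the printed residues
  have hpoles : ∀ p ∈ S, ∃ φ : ℂ → ℂ, ∃ V ∈ 𝓝 p, DifferentiableOn ℂ φ V ∧
      φ p = (fun q => cstar c' D x q * Apoly x a₁ q * ApolyBar x a₂ (1 - q) * omegaW D q) p ∧
      ∀ z ∈ V, z ≠ p → F z = φ z / (z - p) := by
    intro p hpS
    have hp : p ∈ zeroSet D x := (hmemS p).mp hpS
    have hpR : p ∈ rectR D Lm Lp := hzeroR hp
    have hpU : p ∈ U := by
      obtain ⟨h1, h2, h3⟩ := hpR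
      rw [mem_reProdIm]
      have h1' := abs_lt.mp h1
      exact ⟨⟨by linarith [h1'.1], by linarith [h1'.2]⟩, ⟨by linarith, by linarith⟩⟩
    have hpim : 0 < p.im := hUim p hpU
    have hL0 : x.ψ.LFunction p = 0 := hp.2.2
    have hM0 : Mfun x.ψ p = 0 := by
      rw [show Mfun x.ψ p = Yroot x.ψ p * x.ψ.LFunction p from rfl, hL0, mul_zero]
    have hpS' : p ∈ prodZeroSetOmega χ x := mem_prodZeroSetOmega_of_mem_zeroSet χ hp
    have hL1 : deriv x.ψ.LFunction p ≠ 0 :=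
      deriv_LFunction_ne_zero_of_deriv_LL_ne_zero χ hD hχ x hL0 (h_ii p hpS')
    have hM1 : deriv (Mfun x.ψ) p ≠ 0 :=
      GammaFactor.deriv_M_ne_zero_of_simple_zero x.prim x.p_ne_one (Yroot_spec x.prim).1
        (Yroot_spec x.prim).2 hpim hL0 hL1
    -- `g = dslope M p`, holomorphic on `U`, `g(p) = M′(p) ≠ 0`
    set g : ℂ → ℂ := dslope (Mfun x.ψ) p with hg_def
    have hgdiff : DifferentiableOn ℂ g U :=
      (Complex.differentiableOn_dslope (hUo.mem_nhds hpU)).mpr hMdiff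
    have hgp : g p = deriv (Mfun x.ψ) p := dslope_same _ _
    have hgne : {z | g z ≠ 0} ∈ 𝓝 p := by
      have hc : ContinuousAt g p := (hgdiff.differentiableAt (hUo.mem_nhds hpU)).continuousAt
      exact hc.preimage_mem_nhds (isOpen_ne.mem_nhds (by rw [hgp]; exact hM1))
    set V : Set ℂ := U ∩ {z | g z ≠ 0} with hV_def
    have hV : V ∈ 𝓝 p := inter_mem (hUo.mem_nhds hpU) hgne
    refine ⟨fun z => G z * (g z)⁻¹, V, hV, ?_, ?_, ?_⟩
    · intro z hz
      obtain ⟨hzU, hgz⟩ := hz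
      have hGd := differentiableAt_numerator c' x a₁ a₂ hb1 hb2 hb3 (hUim z hzU) (hU0 z hzU)
        (hU1 z hzU)
      have hgd : DifferentiableAt ℂ g z := hgdiff.differentiableAt (hUo.mem_nhds hzU)
      exact (hGd.mul (hgd.inv hgz)).differentiableWithinAt
    · simp only [hG_def, hgp, cstar, div_eq_mul_inv]
      ring
    · intro z hz hzp
      have hgz : g z = Mfun x.ψ z / (z - p) := by
        rw [hg_def, dslope_of_ne _ hzp, slope_def_field, hM0, sub_zero]
      show F z = G z * (g z)⁻¹ / (z - p)
      rw [hFG z, hgz]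
      have hzp' : z - p ≠ 0 := sub_ne_zero.mpr hzp
      by_cases hMz : Mfun x.ψ z = 0
      · rw [hMz]; simp
      · field_simp
  -- the residue theorem
  have hab : (1 : ℝ) / 2 - alpha D < 1 / 2 + alpha D := by linarith
  have hcd : T + Lm < T + Lp := by linarith
  have hSsub : (↑S : Set ℂ) ⊆ Ioo (1 / 2 - alpha D) (1 / 2 + alpha D) ×ℂ Ioo (T + Lm) (T + Lp) := by
    intro p hp
    have hp' : p ∈ zeroSet D x := (hmemS p).mp (Finset.mem_coe.mp hp)
    obtain ⟨h1, h2, h3⟩ := hzeroR hp'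
    rw [mem_reProdIm]
    have h1' := abs_lt.mp h1
    exact ⟨⟨by linarith [h1'.1], by linarith [h1'.2]⟩, ⟨h2, h3⟩⟩
  have key := rectBoundaryIntegral_eq_sum_of_simplePoles hab hcd S F
    (fun q => cstar c' D x q * Apoly x a₁ q * ApolyBar x a₂ (1 - q) * omegaW D q) U hUo hKU hSsub
    hFdiff hpoles
  have h2πI : (2 * π * I : ℂ) ≠ 0 := by simp [Real.pi_ne_zero, I_ne_zero]
  rw [rectIntegral, ← hT, key, ← mul_assoc, one_div_mul_cancel h2πI, one_mul]
  rfl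

end Setting

/-! ## `Z22:(8.1)`a from Proposition 2.2, for all large `D` -/

/-- `L₀ ≤ log D` once `D ≥ ⌈exp L₀⌉₊`. [folklore] -/
private theorem eq81a_threshold_le_ell {L₀ : ℝ} {D : ℕ} (hD : ⌈Real.exp L₀⌉₊ ≤ D) : L₀ ≤ ell D := by
  have h : Real.exp L₀ ≤ D := le_trans (Nat.le_ceil _) (by exact_mod_cast hD)
  exact (Real.le_log_iff_exp_le (lt_of_lt_of_le (Real.exp_pos _) h)).mpr h

/-- **`Z22:(8.1)`, first equality, HOLDS given Proposition 2.2** (the residue theorem on the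
admissible rectangle): for every `c′ ≥ 0`, `Skeleton.Prop22 c′ → Section8aStatements.Eq81a c′` —
for every bound `B` of (7.2), every admissibility pair `(C, c₀)` with `c₀ > 0`, all large `D`
(`𝓛 ≥ max(2, 5πc′+1, π(|C|+c₀+1)+1)` beyond Proposition 2.2's threshold), all `𝐚₁, 𝐚₂`, every
`ψ ∈ Ψ₁` and every admissible rectangle, `sumZeros = rectIntegral (integrandTilde)`. Only (ii) of
Proposition 2.2 is used (simplicity of the poles); Assumption (A) and (7.2) are not.
[cite: Zhang2022LandauSiegel, §8 (8.1) p. 42, tex L2202–L2203] -/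
theorem eq81a_of_prop22 {c' : ℝ} (hc' : 0 ≤ c') (h22 : Skeleton.Prop22 c') : Eq81a c' := by
  intro B C c₀ hc₀
  obtain ⟨-, h_ii, -⟩ := h22
  obtain ⟨D₁, h⟩ := h_ii
  refine ⟨max (max D₁ 3) ⌈Real.exp (max 2 (max (5 * π * c' + 1) (π * (|C| + c₀ + 1) + 1)))⌉₊,
    fun D _ χ hD hq hp _ a₁ a₂ _ _ x hx Lm Lp hR => ?_⟩
  have hD₁ : D₁ ≤ D := le_trans (le_trans (le_max_left _ _) (le_max_left _ _)) hD
  have hD3 : 3 ≤ D := le_trans (le_trans (le_max_right _ _) (le_max_left _ _)) hD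
  have hL := eq81a_threshold_le_ell (le_trans (le_max_right _ _) hD)
  have hℓ2 : 2 ≤ ell D := le_trans (le_max_left _ _) hL
  have hℓc : 5 * π * c' + 1 ≤ ell D := le_trans (le_trans (le_max_left _ _) (le_max_right _ _)) hL
  have hℓC : π * (|C| + c₀ + 1) + 1 ≤ ell D :=
    le_trans (le_trans (le_max_right _ _) (le_max_right _ _)) hL
  have e_ii := h D χ hD₁ hq hp
  -- the parameters
  have hα_eq : alpha D = π / ell D ^ 9 := by rw [alpha, bigP, Real.log_exp]
  have hℓpos : 0 < ell D := by linarith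
  have hα : 0 < alpha D := by rw [hα_eq]; positivity
  have hℓ9 : ell D ≤ ell D ^ 9 := le_self_pow₀ (by linarith) (by norm_num)
  have hαℓ : alpha D * ell D ≤ π := by
    rw [hα_eq, div_mul_eq_mul_div, div_le_iff₀ (by positivity)]
    nlinarith [Real.pi_pos]
  -- `5c′α𝓛 < 1`, hence `Im β₁, Im β₃ ≥ 0` (and `Im β₂ ≥ 0`)
  have h5 : 5 * c' * alpha D * ell D < 1 := by
    have h8 : ell D ≤ ell D ^ 8 := le_self_pow₀ (by linarith) (by norm_num)
    have hkey : 5 * c' * π * ell D < ell D ^ 9 := by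
      have h9 : ell D ^ 9 = ell D ^ 8 * ell D := by ring
      rw [h9]
      have : 5 * π * c' < ell D ^ 8 := by linarith
      nlinarith
    rw [hα_eq]
    calc 5 * c' * (π / ell D ^ 9) * ell D = 5 * c' * π * ell D / ell D ^ 9 := by ring
      _ < 1 := by rw [div_lt_one (by positivity)]; exact hkey
  have hcαℓ : 0 ≤ c' * alpha D * ell D := by positivity
  have hb1 : 0 ≤ (beta1 c' D).im := by
    have : (beta1 c' D).im = alpha D * (1 - 5 * c' * alpha D * ell D) := by simp [beta1]
    rw [this]; exact mul_nonneg hα.le (by linarith)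
  have hb2 : 0 ≤ (beta2 c' D).im := by
    have : (beta2 c' D).im = 2 * alpha D * (1 + c' * alpha D * ell D) := by simp [beta2]
    rw [this]; positivity
  have hb3 : 0 ≤ (beta3 c' D).im := by
    have : (beta3 c' D).im = 3 * alpha D * (1 - c' * alpha D * ell D) := by simp [beta3]
    rw [this]; exact mul_nonneg (by positivity) (by linarith)
  -- `(|C| + c₀ + 1)α < 1`
  have hCα : (|C| + c₀ + 1) * alpha D < 1 := by
    have h1 : alpha D ≤ π / ell D := by
      rw [hα_eq]; exact div_le_div_of_nonneg_left Real.pi_pos.le hℓpos hℓ9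
    have h2 : π / ell D * (π * (|C| + c₀ + 1) + 1) ≤ π := by
      rw [div_mul_eq_mul_div, div_le_iff₀ hℓpos]; nlinarith [Real.pi_pos]
    have h3 : 0 ≤ |C| + c₀ + 1 := by positivity
    nlinarith [Real.pi_gt_three]
  -- the heights of the admissible rectangle
  have hLp1 := hR.1
  have hLm1 := hR.2.1
  have hℓ : 1 < ell D := by linarith
  have hℓ1 : 1 ≤ ell1 D := one_le_pow₀ hℓ.le
  have ht0 : ell1 D ≤ t0 D := pow_le_pow_right₀ hℓ.le (by norm_num)
  have hCabs : C * alpha D ≤ |C| * alpha D := mul_le_mul_of_nonneg_right (le_abs_self C) hα.le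
  have hLp := abs_le.mp hLp1
  have hLm := abs_le.mp hLm1
  have hc₀α : c₀ * alpha D < 1 := by nlinarith [abs_nonneg C]
  have hCα1 : |C| * alpha D < 1 := by nlinarith [abs_nonneg C]
  have hLmLp : Lm < Lp := by linarith
  have hLmpos : c₀ * alpha D < 2 * π * t0 D + Lm := by nlinarith [Real.pi_gt_three]
  exact eq81a_at χ hD3 hp c' x a₁ a₂ hb1 hb2 hb3 hc₀ hα hLmpos hLmLp (fun s hs => e_ii x hx s hs) hR

end Literature.NumberTheory.LFunctions.Zhang2022.Section8aStatements
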